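import Mathlib.Analysis.SpecialFunctions.Pow.Real
import HarnessLib

/-!
# Route `UnitScaleTilt`, crux K1 «MinimiserStabilityRegPr» (stmt-QuantumFields-19200), LANE II «DIVERGENCE RECOVERY AT CURVED `W`» (★★OWNER RULING №23), [I-9] (P2):
# **THE CURRENCY OF THE COARSE-GRADIENT ROW `h9`** — pure real arithmetic folding ✓`Prop7QkcInnerPatchRows.coarseGrad_rows_on_inner` (inner-patch row at the box-plateau
# cutoff `χ`), the (QH1)♮ row at `f := Zχb r` and the `H¹` row of `Zχb r` (✓`cutoffH1_member` ▸ ✓`currency_h10`) into ✓`patch_budget_v2`'s slot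
# `h9 : Gc ≤ 4·As + B·ρ + BC·Cu + BK·K + Ct·e²·Φ`.

Cell `ym3-torus` (HUMAN RULING D-0037, YM ladder rung R3 — YM₃ on T³ is a rung, NOT d = 4, NOT infinite volume, NOT a mass gap, NOT Clay; YM gap NOT proved), width seat
`ym-ust-19200-w1` (gen 16), interim PATCHES1 hand.  THEOREMS ONLY (0 `def`, 0 `sorry`); `--supports stmt-QuantumFields-19200 --as helper`; count-neutral.

LETTERS (all reals; `q = c₀∕cB ≥ 0`, `ℓ3 = ℓ³ > 0`): `X = cB·Σ_{ĉ∈S}‖Ad(T ĉ)(Q′φ)(ĉ₊) − (Q′φ)(ĉ₋)‖²` (the inner-patch coarse-gradient sum), `Gc = q·ℓ3·X` (px9's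
`h8` letter `c₀ℓ³Σ_S …`), `As′ = cB·Σ_S‖fibre(Qkc y) ĉ‖²`, `As = q·ℓ3·As′` (`hPatch`'s `Asi` currency), `Q = ‖Qkc(Zχb r)‖²`, `ρχ = ‖Zχb r‖² ≤ ρ = ‖r‖²`,
`Hχ = H(Zχb r)` (the door functional), `Φ = ‖φ‖²`, `Cu`, `K` the patch's curl and source letters, `Ri = (L^s)⁻¹`.
ROWS IN: `h9 : X ≤ 4As′ + 4Q + C3·e²·(ℓ3⁻¹·Φ)` (✓`coarseGrad_rows_on_inner`), `hQ : q·ℓ3·Q ≤ B·ρχ + B′·Hχ + B″·e·ρχ` ((QH1)♮ at `f := Zχb r`),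
`h10 : Hχ ≤ CW·(Cu + e²Φ + K + Ri²·ρ)` (✓`currency_h10` at `Cδ = 2L^s`).  ROW OUT: the budget's `h9` with
`B := 4(B + B″) + 4B′·CW·Ri²`, `BC = BK := 4B′·CW`, `Ct := 4B′·CW + C3·q`.

References: T. Bałaban, CMP **99** (1985) 389–434 [Balaban1985BackgroundPropagators] ((3.36)-(3.39) p.397: the averaging term against the `H¹` norm); [folklore].
-/

set_option autoImplicit false

namespace Summit.QuantumFields.YangMills.Theorems.Prop7DivRecoveryCurrencyH9

/-- ★★ **THE CURRENCY OF `h9`.**  From the inner-patch coarse-gradient row `X ≤ 4As′ + 4Q + C3·e²·ℓ3⁻¹·Φ`, the (QH1)♮ row `q·ℓ3·Q ≤ B·ρχ + B′·Hχ + B″·e·ρχ` at the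
cut-off remainder, its `H¹` row `Hχ ≤ CW·(Cu + e²Φ + K + Ri²ρ)`, `0 ≤ ρχ ≤ ρ` and `e ≤ 1` (`B, B′, B″, q ≥ 0`): the budget slot
`Gc ≤ 4·As + (4(B + B″) + 4B′·CW·Ri²)·ρ + 4B′·CW·Cu + 4B′·CW·K + (4B′·CW + C3·q)·e²·Φ` for `Gc = q·ℓ3·X`, `As = q·ℓ3·As′`. [folklore] -/
theorem currency_h9 {q ℓ3 X As' Q Φ ρ ρχ Cu K Hχ e C3 B B' B'' CW Ri Gc As : ℝ}
    (hq : 0 ≤ q) (hℓ3 : 0 < ℓ3) (he1 : e ≤ 1)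
    (hB : 0 ≤ B) (hB' : 0 ≤ B') (hB'' : 0 ≤ B'') (hρχ0 : 0 ≤ ρχ) (hρχ : ρχ ≤ ρ)
    (h9 : X ≤ 4 * As' + 4 * Q + C3 * e ^ 2 * (ℓ3⁻¹ * Φ))
    (hQ : q * ℓ3 * Q ≤ B * ρχ + B' * Hχ + B'' * e * ρχ)
    (h10 : Hχ ≤ CW * (Cu + e ^ 2 * Φ + K + Ri ^ 2 * ρ))
    (hGc : Gc = q * ℓ3 * X) (hAs : As = q * ℓ3 * As') :
    Gc ≤ 4 * As + (4 * (B + B'') + 4 * B' * CW * Ri ^ 2) * ρ + 4 * B' * CW * Cu + 4 * B' * CW * K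
      + (4 * B' * CW + C3 * q) * e ^ 2 * Φ := by
  have hqℓ : 0 ≤ q * ℓ3 := mul_nonneg hq hℓ3.le
  have hℓi : ℓ3 * ℓ3⁻¹ = 1 := mul_inv_cancel₀ hℓ3.ne'
  -- multiply the raw row by `q·ℓ3 ≥ 0`
  have h1 : Gc ≤ 4 * As + 4 * (q * ℓ3 * Q) + C3 * q * e ^ 2 * Φ := by
    have h := mul_le_mul_of_nonneg_left h9 hqℓ
    have e1 : q * ℓ3 * (4 * As' + 4 * Q + C3 * e ^ 2 * (ℓ3⁻¹ * Φ))
        = 4 * (q * ℓ3 * As') + 4 * (q * ℓ3 * Q) + C3 * q * e ^ 2 * Φ * (ℓ3 * ℓ3⁻¹) := by ring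
    rw [e1, hℓi, mul_one] at h
    rw [hGc, hAs]
    exact h
  -- the (QH1)♮ row with `ρχ ≤ ρ`, `e ≤ 1`
  have h2 : q * ℓ3 * Q ≤ (B + B'') * ρ + B' * Hχ := by
    have hBe : B'' * e * ρχ ≤ B'' * ρ := by
      calc B'' * e * ρχ ≤ B'' * 1 * ρχ := by
            exact mul_le_mul_of_nonneg_right (mul_le_mul_of_nonneg_left he1 hB'') hρχ0
        _ = B'' * ρχ := by ring
        _ ≤ B'' * ρ := mul_le_mul_of_nonneg_left hρχ hB''
    have hBρ : B * ρχ ≤ B * ρ := mul_le_mul_of_nonneg_left hρχ hB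
    linarith
  -- the `H¹` row
  have h3 : B' * Hχ ≤ B' * (CW * (Cu + e ^ 2 * Φ + K + Ri ^ 2 * ρ)) := mul_le_mul_of_nonneg_left h10 hB'
  have hid : 4 * As + 4 * ((B + B'') * ρ + B' * (CW * (Cu + e ^ 2 * Φ + K + Ri ^ 2 * ρ))) + C3 * q * e ^ 2 * Φ
      = 4 * As + (4 * (B + B'') + 4 * B' * CW * Ri ^ 2) * ρ + 4 * B' * CW * Cu + 4 * B' * CW * K
        + (4 * B' * CW + C3 * q) * e ^ 2 * Φ := by ring
  linarith [h1, h2, h3, hid]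

/-- ★ **THE `h9` COEFFICIENTS ARE NONNEGATIVE** (for ✓`patch_budget_v2`'s `hB hBC hBK hCt`). [folklore] -/
theorem currency_h9_coeff_nonneg {q C3 B B' B'' CW Ri : ℝ} (hq : 0 ≤ q) (hB : 0 ≤ B) (hB' : 0 ≤ B') (hB'' : 0 ≤ B'') (hC3 : 0 ≤ C3) (hCW : 0 ≤ CW) :
    0 ≤ 4 * (B + B'') + 4 * B' * CW * Ri ^ 2 ∧ 0 ≤ 4 * B' * CW ∧ 0 ≤ 4 * B' * CW + C3 * q :=
  ⟨by positivity, by positivity, by positivity⟩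

end Summit.QuantumFields.YangMills.Theorems.Prop7DivRecoveryCurrencyH9
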